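import Summits.QuantumAdvantage.QuantumAdvantage.Theorems.LinnikCubicClassGroupsDegreeOnePrimesEscapeClassPNTSmoothedMain
import Summits.QuantumAdvantage.QuantumAdvantage.Theorems.LinnikCubicClassGroupsDegreeOnePrimesEscapePerCharacterDeficitUnsmoothing
import Summits.QuantumAdvantage.QuantumAdvantage.Theorems.LinnikCubicClassGroupsDegreeOnePrimesEscapePerCharacterDeficitCounting
import Literature.NumberTheory.LFunctions.UniformClassGroupPNTInputs
import HarnessLib

/-!
# The additive class prime number theorem, V: the `θ_C`-form of the dichotomy

Topic `Summits/QuantumAdvantage/QuantumAdvantage/Theorems`, cell B2b-1 (linnik-cubic), PART A, the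
`stub_classPNTAdditive` slice of the crux `DegreeOnePrimesEscape` (stmt-QuantumAdvantage-11543), in
DEGREE-LOCAL form.  HONEST FRAMING: the value of this file is a THEOREM — not summit progress.

From the smoothed dichotomy `smoothedClassSum_dichotomy` (file IV) to the class Chebyshev functions
`θ_C(x) = Σ_{N𝔭 ≤ x, [𝔭] = C} log N𝔭`: unsmoothing class by class with TRIVIAL short-interval bounds
(`abs_theta_sub_smoothedPsiClass_le`: `|θ_C(x) − ψ̃_C(g_x)| ≤ n(log x + 1)(8√x + 2εx + 1)`, no Brun–Titchmarsh,
the factor `h_K ≤ Q⁴` absorbed by `x ≥ Q^{a₂}`), and the main terms `F_x(−1) = x + O(√x + εx)`,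
`F_x(−β) = x^β/β + O(√x + εx)` (`abs_re_fordLaplace_tzTest_neg_one_sub_le`, `abs_re_fordLaplace_tzTest_neg_sub_le`):

* `thetaClass_dichotomy` — for the number fields `K` of degree `n > 1` obeying the family density bound in
  `Q`-form and every `0 < η`: EITHER `|θ_C(x) − x/h| ≤ η x/h` for all `x ≥ Q^{a₂}` and all `C`, OR there is a
  real class group character `χ₁` with a real zero `β₁ ∈ (1 − c/(log|d_K| + log 4), 1)` of `L(s, χ₁)`
  (`ζ_K` if `χ₁ = 1`) and `|θ_C(x) − (x − χ₁(C) x^{β₁}/β₁)/h| ≤ η x/h` for all `x ≥ Q^{a₂}`, all `C`.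
-/

noncomputable section

open Complex Real MeasureTheory Set Filter Topology
open scoped NumberField nonZeroDivisors

namespace Summit.QuantumAdvantage.QuantumAdvantage.Theorems.DegreeOnePrimesEscape

open Literature.NumberTheory.LFunctions Literature.NumberTheory.LFunctions.NumberField
  Literature.NumberTheory.LFunctions.EntireEF Literature.NumberTheory.LFunctions.TZWeight
  Literature.NumberTheory.LFunctions.AbelianDensity

/-! ### The main terms -/

/-- `e^{ε} − 1 ≤ 2ε` for `0 < ε ≤ 1`. -/
theorem exp_sub_one_le_two_mul {ε : ℝ} (hε : 0 < ε) (hε1 : ε ≤ 1) : Real.exp ε - 1 ≤ 2 * ε := by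
  have := Real.abs_exp_sub_one_le (x := ε) (by rw [abs_of_pos hε]; exact hε1)
  rw [abs_of_pos hε] at this
  exact (le_abs_self _).trans this

/-- **`F_x(−1) = x + O(√x + εx)`**: `|Re F_x(−1) − x| ≤ √x + 2εx` for `g_x = tzTest (log x) ε`, `x > 1`,
`0 < ε ≤ 1`, `ε < (log x)/2` (sandwich `∫_{L/2}^{L} e^u ≤ F(−1) ≤ ∫_{L/2−ε}^{L+ε} e^u`). -/
theorem abs_re_fordLaplace_tzTest_neg_one_sub_le {x ε : ℝ} (hx : 1 < x) (hε : 0 < ε) (hε1 : ε ≤ 1)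
    (hεL : ε < Real.log x / 2) :
    |(fordLaplace (tzTest (Real.log x) ε) (-1)).re - x| ≤ Real.sqrt x + 2 * ε * x := by
  have hx0 : 0 < x := by linarith
  set L := Real.log x with hL
  have hL0 : 0 < L := Real.log_pos hx
  have h := fordLaplace_tzTest_real_mem hL0 hε hεL 1
  simp only [Complex.ofReal_one, one_mul] at h
  obtain ⟨hlo, hhi⟩ := h
  rw [integral_exp] at hlo hhi
  have hexpL : Real.exp L = x := by rw [hL, Real.exp_log hx0]
  have hexpL2 : Real.exp (L / 2) = Real.sqrt x := by
    rw [Real.sqrt_eq_rpow, Real.rpow_def_of_pos hx0, ← hL]; ring_nf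
  rw [hexpL, hexpL2] at hlo
  have hup : Real.exp (L + ε) - Real.exp (L / 2 - ε) ≤ x + 2 * ε * x := by
    have h1 : Real.exp (L + ε) = x * Real.exp ε := by rw [Real.exp_add, hexpL]
    have h2 := exp_sub_one_le_two_mul hε hε1
    have h3 := Real.exp_pos (L / 2 - ε)
    nlinarith
  have hsq := Real.sqrt_nonneg x
  rw [abs_le]; constructor <;> nlinarith

/-- **`F_x(−β) = x^β/β + O(√x + εx)`** for `1/2 ≤ β ≤ 1`: `|Re F_x(−β) − x^β/β| ≤ 2√x + 4εx`. -/
theorem abs_re_fordLaplace_tzTest_neg_sub_le {x ε β : ℝ} (hx : 1 < x) (hε : 0 < ε) (hε1 : ε ≤ 1)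
    (hεL : ε < Real.log x / 2) (hβ : 1 / 2 ≤ β) (hβ1 : β ≤ 1) :
    |(fordLaplace (tzTest (Real.log x) ε) (-(β : ℂ))).re - x ^ β / β| ≤ 2 * Real.sqrt x + 4 * ε * x := by
  have hx0 : 0 < x := by linarith
  have hβ0 : 0 < β := by linarith
  set L := Real.log x with hL
  have hL0 : 0 < L := Real.log_pos hx
  obtain ⟨hlo, hhi⟩ := fordLaplace_tzTest_real_mem hL0 hε hεL β
  rw [TZWeight.integral_exp_mul hβ0.ne'] at hlo hhi
  have hxβ : Real.exp (β * L) = x ^ β := by rw [Real.rpow_def_of_pos hx0, ← hL]; ring_nf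
  have hxβ2 : Real.exp (β * (L / 2)) ≤ Real.sqrt x := by
    rw [Real.sqrt_eq_rpow, Real.rpow_def_of_pos hx0, ← hL]
    exact Real.exp_le_exp.2 (by nlinarith)
  have hxβ2' : 0 < Real.exp (β * (L / 2)) := Real.exp_pos _
  have hxβx : x ^ β ≤ x := by
    have := Real.rpow_le_rpow_of_exponent_le hx.le hβ1; rwa [Real.rpow_one] at this
  have hxβ0 : 0 ≤ x ^ β := Real.rpow_nonneg hx0.le _
  -- lower: `(x^β − e^{βL/2})/β ≤ Re F`, so `x^β/β − Re F ≤ e^{βL/2}/β ≤ 2√x`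
  have h1 : x ^ β / β - (fordLaplace (tzTest L ε) (-(β : ℂ))).re ≤ 2 * Real.sqrt x := by
    rw [hxβ] at hlo
    have : Real.exp (β * (L / 2)) / β ≤ 2 * Real.sqrt x := by
      rw [div_le_iff₀ hβ0]; nlinarith [Real.sqrt_nonneg x]
    have e : (x ^ β - Real.exp (β * (L / 2))) / β = x ^ β / β - Real.exp (β * (L / 2)) / β := by ring
    linarith
  -- upper: `Re F ≤ (e^{β(L+ε)} − e^{β(L/2−ε)})/β ≤ x^β e^{βε}/β`, so `Re F − x^β/β ≤ x^β (e^{βε} − 1)/β ≤ 2εx`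
  have h2 : (fordLaplace (tzTest L ε) (-(β : ℂ))).re - x ^ β / β ≤ 4 * ε * x := by
    have he1 : Real.exp (β * (L + ε)) = x ^ β * Real.exp (β * ε) := by rw [mul_add, Real.exp_add, hxβ]
    have he2 : Real.exp (β * ε) - 1 ≤ 2 * (β * ε) := by
      have hβε1 : β * ε ≤ 1 := by nlinarith
      exact exp_sub_one_le_two_mul (by positivity) hβε1
    have he3 : 0 < Real.exp (β * (L / 2 - ε)) := Real.exp_pos _
    have hup : (Real.exp (β * (L + ε)) - Real.exp (β * (L / 2 - ε))) / β ≤ x ^ β / β + 4 * ε * x := by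
      rw [div_le_iff₀ hβ0, he1]
      have : (x ^ β / β + 4 * ε * x) * β = x ^ β + 4 * ε * x * β := by field_simp
      rw [this]
      have hA : x ^ β * (Real.exp (β * ε) - 1) ≤ x ^ β * (2 * (β * ε)) := mul_le_mul_of_nonneg_left he2 hxβ0
      have hB : x ^ β * (2 * (β * ε)) ≤ x * (2 * (β * ε)) :=
        mul_le_mul_of_nonneg_right hxβx (by positivity)
      nlinarith [hA, hB, he3, mul_pos (mul_pos hβ0 hε) hx0]
    linarith
  have h4εx : 0 ≤ 4 * ε * x := by positivity
  rw [abs_le]; constructor <;> linarith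

/-! ### Unsmoothing class by class -/

/-- **`|θ_C(t) − ψ̃_C(g_t)| ≤ n_K (log t + 1)(8√t + 2εt + 1)`** for `g_t = tzTest (log t) ε`, `t > 1`,
`0 < ε ≤ 1` (class by class: `θ_C ≤ ψ_C ≤ ψ̃_C + ψ_C(√t)`, `ψ̃_C ≤ ψ_C(te^ε)`; each class error is at most
the total `ψ_K(√t) + (ψ_K(te^ε) − ψ_K(t)) + (ψ_K(t) − θ_K(t))`, bounded trivially). -/
theorem abs_theta_sub_smoothedPsiClass_le {K : Type} [Field K] [NumberField K] (C : ClassGroup (𝓞 K))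
    {t ε : ℝ} (ht : 1 < t) (hε : 0 < ε) (hε1 : ε ≤ 1) :
    |chebyshevThetaIdealClass K C t - smoothedPsiClass K C (tzTest (Real.log t) ε)| ≤
      Module.finrank ℚ K * ((Real.log t + 1) * (8 * Real.sqrt t + 2 * ε * t + 1)) := by
  classical
  have h1 := chebyshevThetaIdealClass_le_classPsi (K := K) C t
  have h2 := classPsi_le_smoothedPsiClass_add (K := K) C ht hε
  have h3 := smoothedPsiClass_le_classPsi (K := K) C ht hε
  have hexp : t ≤ t * Real.exp ε := by have := Real.one_le_exp hε.le; nlinarith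
  have h4 : classPsi K C t ≤ classPsi K C (t * Real.exp ε) := classPsi_mono C hexp
  -- each class term is bounded by the corresponding total
  have hA : classPsi K C (Real.sqrt t) ≤ chebyshevPsiIdeal K (Real.sqrt t) := classPsi_le_chebyshevPsiIdeal C _
  have hB : classPsi K C (t * Real.exp ε) - classPsi K C t ≤
      chebyshevPsiIdeal K (t * Real.exp ε) - chebyshevPsiIdeal K t := by
    rw [← sum_classPsi (t * Real.exp ε), ← sum_classPsi t, ← Finset.sum_sub_distrib]
    exact Finset.single_le_sum (f := fun C' ↦ classPsi K C' (t * Real.exp ε) - classPsi K C' t)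
      (fun C' _ ↦ sub_nonneg.2 (classPsi_mono C' hexp)) (Finset.mem_univ C)
  have hC : classPsi K C t - chebyshevThetaIdealClass K C t ≤ chebyshevPsiIdeal K t - chebyshevThetaIdeal K t :=
    classPsi_sub_theta_le C t
  have htot := unsmoothing_error_le (K := K) ht hε hε1
  have hpos : 0 ≤ classPsi K C (Real.sqrt t) := classPsi_nonneg C _
  rw [abs_le]; constructor <;> linarith

/-! ### The `θ_C`-form of the dichotomy -/

/-- For a real class group character, `χ(C⁻¹) = χ(C)`. -/
theorem classGroupChar_apply_inv_of_real {K : Type} [Field K] [NumberField K] {χ : ClassGroup (𝓞 K) →* ℂˣ}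
    (hχ : χ * χ = 1) (C : ClassGroup (𝓞 K)) : χ C⁻¹ = χ C := by
  have h2 : χ C * χ C = 1 := by
    have := DFunLike.congr_fun hχ C
    rwa [MonoidHom.mul_apply, MonoidHom.one_apply] at this
  have h1 : χ C⁻¹ * χ C = 1 := by rw [← map_mul, inv_mul_cancel, map_one]
  calc χ C⁻¹ = χ C⁻¹ * (χ C * χ C) := by rw [h2, mul_one]
    _ = χ C := by rw [← mul_assoc, h1, one_mul]

set_option maxHeartbeats 1600000 in
/-- **The `θ_C`-form of the additive class prime number theorem dichotomy** (see the module docstring). -/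
theorem thetaClass_dichotomy (n : ℕ) (hn : 1 < n) {b D a : ℝ} (hb : 0 < b) (hD : 0 < D) (ha : 1 ≤ a)
    {η : ℝ} (hη : 0 < η) :
    ∃ a₂ c : ℝ, 1 ≤ a₂ ∧ 0 < c ∧ c ≤ 1 / (8 * ((n : ℝ) ^ 2 + 1)) ∧
    ∀ (K : Type) [Field K] [NumberField K], Module.finrank ℚ K = n →
      (∀ (T : ℝ), 1 ≤ T → ∀ u : AddChar (Additive (ClassGroup (𝓞 K))) ℂ → Finset ℂ,
        (∀ ψ, ∀ ρ ∈ u ψ, famF K ψ ρ = 0 ∧ 1 / 4 ≤ ρ.re ∧ ρ.re < 1 ∧ |ρ.im| ≤ T) →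
        ∀ α : ℝ, α ≤ 1 →
          ∑ ψ, ∑ ρ ∈ u ψ with α ≤ ρ.re, (famMult K ψ ρ : ℝ) ≤
            D * Real.exp (b * (a * Real.log (ThornerZaman.condQn K) + Real.log (T + 4))) ^ (1 - α)) →
      (∀ x : ℝ, ThornerZaman.condQn K ^ a₂ ≤ x → ∀ C : ClassGroup (𝓞 K),
          |chebyshevThetaIdealClass K C x - x / NumberField.classNumber K| ≤
            η * x / NumberField.classNumber K) ∨
      ∃ (χ₁ : ClassGroup (𝓞 K) →* ℂˣ) (β₁ : ℝ), χ₁ * χ₁ = 1 ∧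
          1 - c / (Real.log ((NumberField.discr K).natAbs : ℝ) + Real.log 4) < β₁ ∧ β₁ < 1 ∧
          classGroupLFunction K χ₁ β₁ = 0 ∧
          ∀ x : ℝ, ThornerZaman.condQn K ^ a₂ ≤ x → ∀ C : ClassGroup (𝓞 K),
            |chebyshevThetaIdealClass K C x -
                (x - ((χ₁ C : ℂ)).re * x ^ β₁ / β₁) / NumberField.classNumber K| ≤
              η * x / NumberField.classNumber K := by
  classical
  have hη4 : 0 < η / 4 := by positivity
  obtain ⟨ν, a₁, c, hν0, hν64, ha₁1, hc, hcn, hmain⟩ := smoothedClassSum_dichotomy n hn hb hD ha hη4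
  -- thresholds: unsmoothing (`unsmoothing_small` with `η/(4h)`, `h ≤ Q⁴`) and the main terms
  set Λu : ℝ := 2 / ν * max 0 (Real.log (44 * ((n : ℝ) + 1) / (ν * (η / 4)))) with hΛu
  have hΛu0 : 0 ≤ Λu := by positivity
  set Λm : ℝ := max 0 (Real.log (64 / η)) with hΛm
  have hΛm0 : 0 ≤ Λm := le_max_left _ _
  set a₂ : ℝ := max a₁ (max (Λu + 16 / ν) (Λm / ν)) with ha₂
  have ha₂a₁ : a₁ ≤ a₂ := le_max_left _ _
  have ha₂u : Λu + 16 / ν ≤ a₂ := le_trans (le_max_left _ _) (le_max_right _ _)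
  have ha₂m : Λm / ν ≤ a₂ := le_trans (le_max_right _ _) (le_max_right _ _)
  have ha₂1 : 1 ≤ a₂ := le_trans ha₁1 ha₂a₁
  refine ⟨a₂, c, ha₂1, hc, hcn, fun K _ _ hKn hdens ↦ ?_⟩
  have hK : 1 < Module.finrank ℚ K := by rw [hKn]; exact hn
  set Q : ℝ := ThornerZaman.condQn K with hQ
  have hQ12 : (12 : ℝ) ≤ Q := ThornerZaman.twelve_le_condQn (K := K) hK
  have hQ1 : (1 : ℝ) < Q := by linarith
  have hlog12 : (2 : ℝ) ≤ Real.log 12 := by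
    rw [Real.le_log_iff_exp_le (by norm_num)]
    have := Real.exp_one_lt_d9
    have h : Real.exp 2 = Real.exp 1 * Real.exp 1 := by rw [← Real.exp_add]; norm_num
    rw [h]; nlinarith [Real.exp_pos (1:ℝ)]
  have hlogQ : 2 ≤ Real.log Q := hlog12.trans (Real.log_le_log (by norm_num) hQ12)
  set h : ℝ := (NumberField.classNumber K : ℝ) with hh
  have hh1 : 1 ≤ h := by rw [hh]; exact_mod_cast one_le_classNumber (K := K)
  have hh0 : 0 < h := by linarith
  have hhne : h ≠ 0 := ne_of_gt hh0
  have hhQ : h ≤ Q ^ 4 := by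
    have := ThornerZaman.classNumber_le_condQn_pow (K := K) hK; rw [← hQ] at this; exact this
  -- common estimates at `x ≥ Q^{a₂}`
  have hcommon : ∀ x : ℝ, Q ^ a₂ ≤ x → Q ^ a₁ ≤ x ∧ 1 < x ∧
      (∀ C : ClassGroup (𝓞 K), h * |chebyshevThetaIdealClass K C x -
          smoothedPsiClass K C (tzTest (Real.log x) (x ^ (-ν)))| ≤ η / 4 * x) ∧
      Real.sqrt x ≤ η / 64 * x ∧ x ^ (-ν) * x ≤ η / 64 * x ∧
      0 < x ^ (-ν) ∧ x ^ (-ν) ≤ 1 ∧ x ^ (-ν) < Real.log x / 2 := by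
    intro x hx
    have hxa₁ : Q ^ a₁ ≤ x := le_trans (Real.rpow_le_rpow_of_exponent_le hQ1.le ha₂a₁) hx
    have hxQ : Q ≤ x := by
      have : Q ^ (1 : ℝ) ≤ Q ^ a₂ := Real.rpow_le_rpow_of_exponent_le hQ1.le ha₂1
      rw [Real.rpow_one] at this; linarith
    have hx1 : 1 < x := by linarith
    have hx0 : 0 < x := by linarith
    set L : ℝ := Real.log x with hL
    have hLQ : a₂ * Real.log Q ≤ L := by
      have := Real.log_le_log (by positivity) hx
      rwa [Real.log_rpow (by linarith)] at this
    have hL2a : 2 * a₂ ≤ L := by nlinarith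
    have hL2 : 2 ≤ L := by linarith
    have hL0 : 0 < L := by linarith
    have hexpL : Real.exp L = x := by rw [hL, Real.exp_log hx0]
    set ε : ℝ := x ^ (-ν) with hε
    have hε0 : 0 < ε := Real.rpow_pos_of_pos hx0 _
    have hε1 : ε ≤ 1 := Real.rpow_le_one_of_one_le_of_nonpos hx1.le (by linarith)
    have hε1' : ε < 1 := Real.rpow_lt_one_of_one_lt_of_neg hx1 (by linarith)
    have hεL : ε < L / 2 := by linarith
    -- unsmoothing
    have hxe : Real.exp 1 ≤ x := by rw [← hexpL]; exact Real.exp_le_exp.2 (by linarith)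
    have hU : ∀ C : ClassGroup (𝓞 K), h * |chebyshevThetaIdealClass K C x -
        smoothedPsiClass K C (tzTest L ε)| ≤ η / 4 * x := by
      intro C
      have h1 := abs_theta_sub_smoothedPsiClass_le C hx1 hε0 hε1
      rw [hKn] at h1
      have hlarge : 2 / ν * Real.log (44 * ((n : ℝ) * h + 1) / (ν * (η / 4))) ≤ L := by
        have hcmp : 44 * ((n : ℝ) * h + 1) / (ν * (η / 4)) ≤
            (44 * ((n : ℝ) + 1) / (ν * (η / 4))) * Q ^ 4 := by
          rw [div_mul_eq_mul_div, div_le_div_iff_of_pos_right (by positivity)]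
          have hQ4 : 1 ≤ Q ^ 4 := one_le_pow₀ hQ1.le
          have hn0 : (0 : ℝ) ≤ n := Nat.cast_nonneg _
          nlinarith [mul_le_mul_of_nonneg_left hhQ hn0]
        have hlogle : Real.log (44 * ((n : ℝ) * h + 1) / (ν * (η / 4))) ≤
            max 0 (Real.log (44 * ((n : ℝ) + 1) / (ν * (η / 4)))) + 4 * Real.log Q := by
          refine (Real.log_le_log (by positivity) hcmp).trans ?_
          rw [Real.log_mul (by positivity) (by positivity), Real.log_pow]
          push_cast
          linarith [le_max_right 0 (Real.log (44 * ((n : ℝ) + 1) / (ν * (η / 4))))]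
        have h2ν : 0 < 2 / ν := by positivity
        calc 2 / ν * Real.log (44 * ((n : ℝ) * h + 1) / (ν * (η / 4)))
            ≤ 2 / ν * (max 0 (Real.log (44 * ((n : ℝ) + 1) / (ν * (η / 4)))) + 4 * Real.log Q) :=
              mul_le_mul_of_nonneg_left hlogle h2ν.le
          _ = Λu + 8 / ν * Real.log Q := by rw [hΛu]; ring
          _ ≤ (Λu + 16 / ν) * Real.log Q := by
              rw [add_mul]
              have : Λu ≤ Λu * Real.log Q := by nlinarith
              have h816 : 8 / ν * Real.log Q ≤ 16 / ν * Real.log Q :=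
                mul_le_mul_of_nonneg_right (div_le_div_of_nonneg_right (by norm_num) hν0.le) (by linarith)
              linarith
          _ ≤ a₂ * Real.log Q := mul_le_mul_of_nonneg_right ha₂u (by linarith)
          _ ≤ L := hLQ
      have hsmall := unsmoothing_small (n := (n : ℝ) * h) (ν := ν) (η := η / 4) (t := x)
        (by positivity) hν0 (by linarith) (by positivity) hxe hlarge
      have e1 : (n : ℝ) * h * ((Real.log x + 1) * (8 * Real.sqrt x + 2 * x ^ (-ν) * x + 1)) =
          h * ((n : ℝ) * ((Real.log x + 1) * (8 * Real.sqrt x + 2 * ε * x + 1))) := by rw [hε]; ring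
      rw [e1] at hsmall
      have := mul_le_mul_of_nonneg_left h1 hh0.le
      linarith
    -- the main-term errors: `√x ≤ η x/64`, `εx ≤ η x/64`
    have hνL : Λm ≤ ν * L := by
      have := (div_le_iff₀ hν0).1 ha₂m; nlinarith
    have hsqrt : Real.sqrt x ≤ η / 64 * x := by
      have h64 : 64 / η ≤ Real.exp (L / 2) := by
        refine le_exp_of_log_le (by positivity) ?_
        have : Real.log (64 / η) ≤ Λm := le_max_right _ _
        have hν1 : ν ≤ 1 := by linarith
        nlinarith
      have hs : Real.sqrt x = Real.exp (L / 2) := by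
        rw [Real.sqrt_eq_rpow, Real.rpow_def_of_pos hx0, ← hL]; ring_nf
      have hss : Real.exp (L / 2) * Real.exp (L / 2) = x := by rw [← Real.exp_add, ← hexpL]; ring_nf
      rw [hs]
      have := mul_le_mul_of_nonneg_left h64 (Real.exp_pos (L / 2)).le
      rw [hss] at this
      have e : Real.exp (L / 2) = η / 64 * (Real.exp (L / 2) * (64 / η)) := by field_simp
      rw [e]; exact mul_le_mul_of_nonneg_left this (by positivity)
    have hεx : ε * x ≤ η / 64 * x := by
      refine mul_le_mul_of_nonneg_right ?_ hx0.le
      have h64 : 64 / η ≤ Real.exp (ν * L) :=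
        le_exp_of_log_le (by positivity) ((le_max_right _ _).trans hνL)
      have hεe : ε = (Real.exp (ν * L))⁻¹ := by
        rw [hε, Real.rpow_def_of_pos hx0, ← hL, ← Real.exp_neg]; ring_nf
      rw [hεe, inv_le_comm₀ (Real.exp_pos _) (by positivity)]
      calc (η / 64)⁻¹ = 64 / η := by rw [inv_div]
        _ ≤ _ := h64
    exact ⟨hxa₁, hx1, hU, hsqrt, hεx, hε0, hε1, hεL⟩
  rcases hmain K hKn hdens with hgood | ⟨ψ₁, β₁, hz, hβlow, hβ1, hreal, hexc⟩
  · -- no exceptional zero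
    left
    intro x hx C
    obtain ⟨hxa₁, hx1, hU, hsqrt, hεx, hε0, hε1, hεL⟩ := hcommon x hx
    have hx0 : 0 < x := by linarith
    have h1 := hgood x hxa₁ C
    have h1' := (Complex.abs_re_le_norm _).trans h1
    simp only [Complex.sub_re, Complex.mul_re, Complex.natCast_re, Complex.natCast_im,
      Complex.ofReal_re, Complex.ofReal_im, mul_zero, sub_zero] at h1'
    have h2 := abs_re_fordLaplace_tzTest_neg_one_sub_le hx1 hε0 hε1 hεL
    have h3 := hU C
    -- `|h θ_C − x| ≤ η x`
    have hkey : |h * chebyshevThetaIdealClass K C x - x| ≤ η * x := by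
      have hD : |h * (chebyshevThetaIdealClass K C x -
          smoothedPsiClass K C (tzTest (Real.log x) (x ^ (-ν))))| ≤ η / 4 * x := by
        rw [abs_mul, abs_of_pos hh0]; exact h3
      have hD' := abs_le.1 hD
      rw [abs_le] at h1' h2 ⊢
      rw [← hh] at h1'
      have hηx : 0 < η * x := mul_pos hη hx0
      constructor <;> linarith [hD'.1, hD'.2, h1'.1, h1'.2, h2.1, h2.2, hsqrt, hεx]
    have e : chebyshevThetaIdealClass K C x - x / h = (h * chebyshevThetaIdealClass K C x - x) / h := by
      field_simp
    rw [e, abs_div, abs_of_pos hh0, div_le_div_iff_of_pos_right hh0]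
    exact hkey
  · -- the exceptional zero
    right
    set χ₁ : ClassGroup (𝓞 K) →* ℂˣ := (toMulHom ψ₁).toHomUnits with hχ₁
    have hβ1ne : ((β₁ : ℝ) : ℂ) ≠ 1 := by
      intro h'; apply hβ1.ne; exact_mod_cast h'
    have hLzero : classGroupLFunction K χ₁ β₁ = 0 := by
      by_cases hψ : ψ₁ = 0
      · have h0 : dedekindZeta₁ K β₁ = 0 := by rw [hψ, famF_zero] at hz; exact hz
        have hχ1 : χ₁ = 1 := by rw [hχ₁, hψ]; exact toHomUnits_toMulHom_zero
        rw [hχ1]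
        by_contra hne
        exact ((dedekindZeta₁_ne_zero_iff (K := K) hβ1ne).2 hne) h0
      · have h0 : classGroupLFunction₀ K χ₁ β₁ = 0 := by rw [famF_of_ne hψ] at hz; exact hz
        rwa [classGroupLFunction₀_eq χ₁ hβ1ne (toHomUnits_ne_one hψ)] at h0
    -- `β₁ ≥ 1/2`
    have hβhalf : 1 / 2 ≤ β₁ := by
      have hlog4 : 1 < Real.log 4 := by
        have : Real.log 4 = 2 * Real.log 2 := by
          rw [show (4:ℝ) = 2 ^ 2 by norm_num, Real.log_pow]; norm_num
        rw [this]; have := Real.log_two_gt_d9; linarith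
      have hlogd : 0 ≤ Real.log ((NumberField.discr K).natAbs : ℝ) := Real.log_natCast_nonneg _
      have hc2 : c ≤ 1 / 2 := by
        refine hcn.trans ?_
        rw [div_le_div_iff_of_pos_left one_pos (by positivity) (by norm_num)]; nlinarith
      have : c / (Real.log ((NumberField.discr K).natAbs : ℝ) + Real.log 4) ≤ 1 / 2 := by
        rw [div_le_iff₀ (by linarith)]; nlinarith
      linarith
    refine ⟨χ₁, β₁, hreal, hβlow, hβ1, hLzero, fun x hx C ↦ ?_⟩
    obtain ⟨hxa₁, hx1, hU, hsqrt, hεx, hε0, hε1, hεL⟩ := hcommon x hx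
    have hx0 : 0 < x := by linarith
    have h1 := hexc x hxa₁ C
    have h1' := (Complex.abs_re_le_norm _).trans h1
    -- the exceptional term is real: `Re(ψ₁(C⁻¹) F(−β₁)) = Re χ₁(C) · Re F(−β₁)`
    have hFreal : (fordLaplace (tzTest (Real.log x) (x ^ (-ν))) (-(β₁ : ℂ))).im = 0 := by
      rw [fordLaplace_tzTest_ofReal (Real.log_pos hx1) hε0 β₁, Complex.ofReal_im]
    have hψC : ψ₁ (Additive.ofMul C⁻¹) = (χ₁ C : ℂ) := by
      rw [← classGroupChar_apply_inv_of_real hreal C]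
      exact (toHomUnits_toMulHom_apply ψ₁ C⁻¹).symm
    simp only [Complex.add_re, Complex.sub_re, Complex.mul_re, Complex.natCast_re, Complex.natCast_im,
      Complex.ofReal_re, Complex.ofReal_im, mul_zero, sub_zero, hFreal, hψC] at h1'
    have h2 := abs_re_fordLaplace_tzTest_neg_one_sub_le hx1 hε0 hε1 hεL
    have h4 := abs_re_fordLaplace_tzTest_neg_sub_le hx1 hε0 hε1 hεL hβhalf hβ1.le
    have h3 := hU C
    have hχre := abs_re_classGroupChar_apply_le hreal C
    -- `|h θ_C − (x − Re χ₁(C) x^{β₁}/β₁)| ≤ η x`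
    set m : ℝ := x ^ β₁ / β₁ with hmdef
    have hkey : |h * chebyshevThetaIdealClass K C x - (x - ((χ₁ C : ℂ)).re * m)| ≤ η * x := by
      have hD : |h * (chebyshevThetaIdealClass K C x -
          smoothedPsiClass K C (tzTest (Real.log x) (x ^ (-ν))))| ≤ η / 4 * x := by
        rw [abs_mul, abs_of_pos hh0]; exact h3
      have hD' := abs_le.1 hD
      rw [← hh] at h1'
      -- the product term: `|Re χ₁(C)| ≤ 1`
      set r : ℝ := ((χ₁ C : ℂ)).re with hr
      set Fβ : ℝ := (fordLaplace (tzTest (Real.log x) (x ^ (-ν))) (-(β₁ : ℂ))).re with hFβ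
      have hprod : |r * Fβ - r * m| ≤ 2 * Real.sqrt x + 4 * x ^ (-ν) * x := by
        rw [← mul_sub, abs_mul]
        calc |r| * |Fβ - m| ≤ 1 * (2 * Real.sqrt x + 4 * x ^ (-ν) * x) :=
              mul_le_mul hχre h4 (abs_nonneg _) zero_le_one
          _ = _ := one_mul _
      have hprod' := abs_le.1 hprod
      rw [abs_le] at h1' h2 ⊢
      have hηx : 0 < η * x := mul_pos hη hx0
      constructor <;> linarith [hD'.1, hD'.2, h1'.1, h1'.2, h2.1, h2.2, hprod'.1, hprod'.2, hsqrt, hεx]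
    rw [hmdef] at hkey
    rw [mul_div_assoc]
    have e : chebyshevThetaIdealClass K C x - (x - ((χ₁ C : ℂ)).re * (x ^ β₁ / β₁)) / h =
        (h * chebyshevThetaIdealClass K C x - (x - ((χ₁ C : ℂ)).re * (x ^ β₁ / β₁))) / h := by
      field_simp
    rw [e, abs_div, abs_of_pos hh0, div_le_div_iff_of_pos_right hh0]
    exact hkey

end Summit.QuantumAdvantage.QuantumAdvantage.Theorems.DegreeOnePrimesEscape

end
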